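import Summits.BirchSwinnertonDyer.BirchSwinnertonDyer.Theorems.CMKolyvaginAtInertTwoEigenPairingAtTwo
import Literature.NumberTheory.EllipticCurves.HeegnerPointsKolyvaginProp82Proofs
import HarnessLib

/-!
# Route `CMKolyvaginAtInertTwo`, crux `CMKolyvaginExactAtInertTwo` (stmt-BirchSwinnertonDyer-24277):
# the local-duality descent step AT 2 WITH THE ODD-`p` EXPONENT — the one-bit loss of the eigen route
# (g2, p589581) is recovered by not splitting a class into `τ`-eigencomponents (pure algebra, level `2^M`)

Seat `bsd-line-cmk2-p1` g6 (cell `bsd-print-cf2`); helper (`--supports stmt-BirchSwinnertonDyer-24277`).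
THEOREMS ONLY (finite abelian groups; no definition, no named fact, no `sorry`); no item is closed;
BSD is not proved by this.

SETTING (as in g2's `KolyvaginEigenTwo`, file `…EigenPairingAtTwo.lean`): `T` abelian killed by `2^M`
(`M ≥ 1`), `#T = 4^M`, `#T[2] = 4` (`T = E[2^M]`), `ι` an additive involution of TRANSPOSITION type
(some `2`-torsion vector is moved — complex conjugation when `Δ_E < 0`), `e : T × T → A` biadditive,
alternating, left-non-degenerate (the pairing of the reciprocity binder `hRT`). g2 proved: eigen-lines
`T^{ι=1} = ℤu`, `T^{ι=−1} = ℤw` cyclic of order `2^M` meeting in `r = 2^{M−1}u = 2^{M−1}w`; `e(u,w)` of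
order `2^{M−1}` (ONE BIT SHORT); hence for a `ι`-FIXED `x` and anti-fixed `y₀` with `2^a y₀ ≠ 0`,
`e(x,y₀) = 0 ⟹ 2^{M−a} x = 0` (`descent_step_two`) — versus McCallum's `p^{M−1−a}` at odd `p`.

WHAT IS NEW. For an ARBITRARY `x ∈ T` (the Frobenius value `[s, τ']` of an arbitrary, not
`τ`-eigen, Selmer class) and an anti-fixed `y₀` (`2^a y₀ ≠ 0`) with `e(x, y₀) = 0`:
**`2^{M−a−1}·(x + ιx) = 0`** (`sharp_descent_step_two`) — the odd-`p` exponent for the class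
`(1 + τ)s`; symmetrically `2^{M−a−1}·(x − ιx) = 0` for a fixed `y₀` (`…_of_fixed`). (Applied to a
fixed `x` it returns g2's `2^{M−a}x = 0`; at `M = 1`, `a = 0` it is the `𝔽₂²` statement behind p607160:
`x` is `ι`-fixed.) MECHANISM: the annihilator of `r` under `e(·, r)` is EXACTLY `ℤu + ℤw`
(`mem_sup_zmultiples_of_pairing_eq_zero`: `ℤu + ℤw ⊆ r^⊥` as `e(u,r) = 2^{M−1}e(u,w) = 0`; both have
index `2` — `#(ℤu + ℤw) ≥ 2^M·2^{M−1}` by the injection `(i, j) ↦ iu + jw`, and `r^⊥ ≠ T` by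
non-degeneracy); `r ∈ ℤy₀` (the unique element of order `2` on the line `ℤw`), so `e(x, y₀) = 0` puts
`x = βu + δw` IN `ℤu + ℤw`, where `x + ιx = 2βu` and g2's `pow_nsmul_eq_zero_of_pairing_eq_zero_two`
applied to `βu` gives `2^{M−a}βu = 0`.

USE. This is the level-`2^M` leaf (B) at `2` in non-eigen form for the `τ`-part of a future `M₀ ≥ 1`
descent (the global assembly at level `2^M` also needs the depth-`M` Čebotarev / Frobenius bridge at
`2`, KERNEL-STATUS §3 item 5 — not here). References: [McCallumLMS1991] §5 Lemma 5.3 (p odd);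
[GrossLMS1991] Prop. 8.1 (p odd); the memo `Cruxes/CMExactDescentAtTwo/MEMO-tau-line-at-two.md` §4.
-/

set_option autoImplicit false
set_option linter.dupNamespace false

open scoped Classical

namespace Summit.BirchSwinnertonDyer.BirchSwinnertonDyer.Theorems.KolyvaginDescentTwo

open Literature.NumberTheory.EllipticCurves
open Literature.NumberTheory.EllipticCurves.KolyvaginEigenPow
open Summit.BirchSwinnertonDyer.BirchSwinnertonDyer.Theorems.KolyvaginEigenTwo

variable {T : Type*} [AddCommGroup T] {M : ℕ}

/-! ### §1 The `2`-torsion of the line `ℤw` -/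

/-- On a line `ℤw` with `w` of order `2^M` (`M ≥ 1`), the only `2`-torsion elements are `0` and
`r = 2^{M−1} w`. [folklore] -/
theorem eq_zero_or_eq_of_mem_zmultiples_of_two_nsmul (hM : 1 ≤ M) {w y : T}
    (how : addOrderOf w = 2 ^ M) (hy : y ∈ AddSubgroup.zmultiples w) (h2 : 2 • y = 0) :
    y = 0 ∨ y = 2 ^ (M - 1) • w := by
  obtain ⟨k, rfl⟩ := AddSubgroup.mem_zmultiples_iff.mp hy
  -- `2^M ∣ 2k`, so `k = 2^{M-1} k'`
  have hdvd : ((2 ^ M : ℕ) : ℤ) ∣ 2 * k := by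
    rw [← how, addOrderOf_dvd_iff_zsmul_eq_zero, mul_zsmul, two_zsmul, ← two_nsmul]
    exact h2
  obtain ⟨k', hk'⟩ : ((2 ^ (M - 1) : ℕ) : ℤ) ∣ k := by
    obtain ⟨n, rfl⟩ : ∃ n, M = n + 1 := ⟨M - 1, by omega⟩
    rw [Nat.add_sub_cancel]
    rw [pow_succ, Nat.cast_mul, Nat.cast_ofNat, mul_comm ((2 ^ n : ℕ) : ℤ) 2] at hdvd
    exact (mul_dvd_mul_iff_left two_ne_zero).mp hdvd
  -- `r + r = 0`
  have hr2 : (2 ^ (M - 1) • w) + (2 ^ (M - 1) • w) = 0 := by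
    rw [← two_nsmul, ← mul_nsmul', ← pow_succ', Nat.sub_add_cancel hM, ← how]
    exact addOrderOf_nsmul_eq_zero w
  rw [hk', mul_comm, mul_zsmul, natCast_zsmul]
  -- `k' • r ∈ {0, r}`
  obtain ⟨j, hj⟩ : ∃ j : ℤ, k' = k' % 2 + j * 2 := ⟨k' / 2, by omega⟩
  rw [hj, add_zsmul, mul_zsmul, two_zsmul, hr2, zsmul_zero, add_zero]
  rcases Int.emod_two_eq_zero_or_one k' with h | h
  · left; rw [h, zero_zsmul]
  · right; rw [h, one_zsmul]

/-! ### §2 The annihilator of `r` is exactly `ℤu + ℤw` -/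

/-- **`#(ℤu + ℤw) ≥ 2^M · 2^{M−1}`** for eigen-generators `u` (`ιu = u`), `w` (`ιw = −w`) of order
`2^M`: the map `(i, j) ↦ iu + jw`, `i < 2^M`, `j < 2^{M−1}`, is injective (a coincidence gives
`(i − i')u = (j' − j)w` fixed and anti-fixed, hence `2`-torsion on the line `ℤw`, hence `0` or `r`,
forcing `j = j'` and then `i = i'`). [folklore] -/
theorem card_sup_zmultiples_ge (hM : 1 ≤ M) (ι : T →+ T) {u w : T} (hιu : ι u = u) (hιw : ι w = -w)
    (hou : addOrderOf u = 2 ^ M) (how : addOrderOf w = 2 ^ M) [Finite T] :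
    2 ^ M * 2 ^ (M - 1) ≤ Nat.card (AddSubgroup.zmultiples u ⊔ AddSubgroup.zmultiples w : AddSubgroup T) := by
  set H : AddSubgroup T := AddSubgroup.zmultiples u ⊔ AddSubgroup.zmultiples w with hH
  let f : Fin (2 ^ M) × Fin (2 ^ (M - 1)) → H := fun ij ↦
    ⟨(ij.1 : ℕ) • u + (ij.2 : ℕ) • w, add_mem
      (AddSubgroup.mem_sup_left (AddSubgroup.nsmul_mem _ (AddSubgroup.mem_zmultiples u) _))
      (AddSubgroup.mem_sup_right (AddSubgroup.nsmul_mem _ (AddSubgroup.mem_zmultiples w) _))⟩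
  have hf : Function.Injective f := by
    rintro ⟨i, j⟩ ⟨i', j'⟩ hij
    have h0 : (i : ℕ) • u + (j : ℕ) • w = (i' : ℕ) • u + (j' : ℕ) • w := congrArg Subtype.val hij
    -- `y := (i - i') • u = (j' - j) • w` is fixed and anti-fixed, hence `2 y = 0`
    have h0' : (i : ℤ) • u + (j : ℤ) • w = (i' : ℤ) • u + (j' : ℤ) • w := by
      simpa only [natCast_zsmul] using h0
    have hy : ((i : ℤ) - i') • u = ((j' : ℤ) - j) • w := by
      calc ((i : ℤ) - i') • u = ((i : ℤ) • u + (j : ℤ) • w) - ((i' : ℤ) • u + (j : ℤ) • w) := by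
              rw [sub_smul]; abel
        _ = ((i' : ℤ) • u + (j' : ℤ) • w) - ((i' : ℤ) • u + (j : ℤ) • w) := by rw [h0']
        _ = ((j' : ℤ) - j) • w := by rw [sub_smul]; abel
    have hfix : ι (((j' : ℤ) - j) • w) = ((j' : ℤ) - j) • w := by rw [← hy, map_zsmul, hιu]
    have hanti : ι (((j' : ℤ) - j) • w) = -(((j' : ℤ) - j) • w) := by rw [map_zsmul, hιw, zsmul_neg]
    have h2y : 2 • (((j' : ℤ) - j) • w) = 0 := by
      rw [two_nsmul]
      nth_rw 1 [← hfix]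
      rw [hanti, neg_add_cancel]
    -- so it is `0` or `r`; in both cases `2^{M-1} ∣ j' - j`, hence `j = j'`
    have hjj : ((2 ^ (M - 1) : ℕ) : ℤ) ∣ (j' : ℤ) - j := by
      rcases eq_zero_or_eq_of_mem_zmultiples_of_two_nsmul hM how
        (AddSubgroup.zsmul_mem_zmultiples w _) h2y with h | h
      · have : ((2 ^ M : ℕ) : ℤ) ∣ (j' : ℤ) - j := by
          have hd := addOrderOf_dvd_iff_zsmul_eq_zero.mpr h
          rwa [how] at hd
        exact (Int.natCast_dvd_natCast.mpr (Nat.pow_dvd_pow 2 (Nat.sub_le M 1))).trans this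
      · have h' : ((j' : ℤ) - j - (2 ^ (M - 1) : ℕ)) • w = 0 := by
          rw [sub_smul, h, natCast_zsmul, sub_self]
        have : ((2 ^ M : ℕ) : ℤ) ∣ (j' : ℤ) - j - (2 ^ (M - 1) : ℕ) := by
          have hd := addOrderOf_dvd_iff_zsmul_eq_zero.mpr h'
          rwa [how] at hd
        have h2 : ((2 ^ (M - 1) : ℕ) : ℤ) ∣ (j' : ℤ) - j - (2 ^ (M - 1) : ℕ) :=
          (Int.natCast_dvd_natCast.mpr (Nat.pow_dvd_pow 2 (Nat.sub_le M 1))).trans this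
        simpa using h2.add (dvd_refl (((2 ^ (M - 1) : ℕ) : ℤ)))
    have hjeq : j = j' := by
      apply Fin.ext
      have hj1 := j.2; have hj2 := j'.2
      have habs : |(j' : ℤ) - j| < (2 ^ (M - 1) : ℕ) := by
        rw [abs_sub_lt_iff]; constructor <;> omega
      have := Int.eq_zero_of_abs_lt_dvd hjj habs
      omega
    subst hjeq
    have hii : ((i : ℤ) - i') • u = 0 := by rw [hy, sub_self, zero_zsmul]
    have hdi : ((2 ^ M : ℕ) : ℤ) ∣ (i : ℤ) - i' := by
      have hd := addOrderOf_dvd_iff_zsmul_eq_zero.mpr hii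
      rwa [hou] at hd
    have hieq : i = i' := by
      apply Fin.ext
      have hi1 := i.2; have hi2 := i'.2
      have habs : |(i : ℤ) - i'| < (2 ^ M : ℕ) := by
        rw [abs_sub_lt_iff]; constructor <;> omega
      have := Int.eq_zero_of_abs_lt_dvd hdi habs
      omega
    rw [hieq]
  have hcard := Nat.card_le_card_of_injective f hf
  rwa [Nat.card_prod, Nat.card_eq_fintype_card, Fintype.card_fin, Nat.card_eq_fintype_card,
    Fintype.card_fin] at hcard

/-- **The annihilator of `r = 2^{M−1}w` under `e(·, r)` is `ℤu + ℤw`.** With `T` of order `4^M`,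
`e` alternating and left-non-degenerate and `e(u,w)` of order `2^{M−1}`: if `e(x, 2^{M−1}w) = 0`
then `x = βu + δw` for some `β, δ ∈ ℤ` (`ℤu + ℤw ⊆ r^⊥`, `#(ℤu + ℤw) ≥ #T/2 ≥ #r^⊥` as `r^⊥ ≠ T`).
[folklore] -/
theorem mem_sup_zmultiples_of_pairing_eq_zero [Finite T] (hM : 1 ≤ M)
    (hcard : Nat.card T = 2 ^ (2 * M)) (ι : T →+ T) {u w : T} (hιu : ι u = u) (hιw : ι w = -w)
    (hou : addOrderOf u = 2 ^ M) (how : addOrderOf w = 2 ^ M)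
    {A : Type*} [AddCommGroup A] (e : T →+ T →+ A) (halt : ∀ x, e x x = 0)
    (hnd : ∀ x, (∀ y, e x y = 0) → x = 0) (hω : addOrderOf (e u w) = 2 ^ (M - 1))
    {x : T} (hx : e x (2 ^ (M - 1) • w) = 0) :
    ∃ β δ : ℤ, x = β • u + δ • w := by
  set r : T := 2 ^ (M - 1) • w with hr
  set H : AddSubgroup T := AddSubgroup.zmultiples u ⊔ AddSubgroup.zmultiples w with hH
  set K : AddSubgroup T := (e.flip r).ker with hK
  -- `H ≤ K`
  have hur : e u r = 0 := by
    rw [hr, map_nsmul, ← hω]; exact addOrderOf_nsmul_eq_zero (e u w)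
  have hwr : e w r = 0 := by rw [hr, map_nsmul, halt, smul_zero]
  have hHK : H ≤ K := by
    rw [hH, sup_le_iff, AddSubgroup.zmultiples_le, AddSubgroup.zmultiples_le, hK,
      AddMonoidHom.mem_ker, AddMonoidHom.mem_ker, AddMonoidHom.flip_apply, AddMonoidHom.flip_apply]
    exact ⟨hur, hwr⟩
  -- `K ≠ ⊤`: `r ≠ 0` pairs non-trivially with something
  have hr0 : r ≠ 0 := by
    rw [hr]
    refine nsmul_ne_zero_of_lt_addOrderOf (pow_ne_zero _ two_ne_zero) ?_
    rw [how]
    exact Nat.pow_lt_pow_right (by norm_num) (by omega)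
  have hKtop : K ≠ ⊤ := by
    intro htop
    apply hr0
    refine hnd r fun t ↦ ?_
    have ht : t ∈ K := htop ▸ AddSubgroup.mem_top t
    rw [hK, AddMonoidHom.mem_ker, AddMonoidHom.flip_apply] at ht
    rw [KolyvaginReciprocity.pairing_antisymm e halt t r, ht, neg_zero]
  -- cardinalities: `#K · 2 ≤ #T = 4^M ≤ 2 · #H`
  haveI : Finite K := inferInstance
  have hidx : 2 ≤ K.index := by
    have h1 : K.index ≠ 1 := fun h ↦ hKtop (AddSubgroup.index_eq_one.mp h)
    have h0 : K.index ≠ 0 := AddSubgroup.index_ne_zero_of_finite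
    omega
  have hKcard : Nat.card K * 2 ≤ 2 ^ (2 * M) := by
    rw [← hcard, ← K.card_mul_index]
    exact Nat.mul_le_mul_left _ hidx
  have hHcard : 2 ^ (2 * M) ≤ Nat.card H * 2 := by
    have h := card_sup_zmultiples_ge hM ι hιu hιw hou how
    have hpow : 2 ^ (2 * M) = 2 ^ M * 2 ^ (M - 1) * 2 := by
      rw [mul_assoc, ← pow_succ, Nat.sub_add_cancel hM, ← pow_add, two_mul]
    rw [hpow]
    exact Nat.mul_le_mul_right 2 h
  have hKH : Nat.card K ≤ Nat.card H := by omega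
  have hEq : H = K := AddSubgroup.eq_of_le_of_card_ge hHK hKH
  have hxK : x ∈ K := by rw [hK, AddMonoidHom.mem_ker, AddMonoidHom.flip_apply]; exact hx
  rw [← hEq, hH] at hxK
  obtain ⟨y, hy, z, hz, rfl⟩ := AddSubgroup.mem_sup.mp hxK
  obtain ⟨β, rfl⟩ := AddSubgroup.mem_zmultiples_iff.mp hy
  obtain ⟨δ, rfl⟩ := AddSubgroup.mem_zmultiples_iff.mp hz
  exact ⟨β, δ, rfl⟩

/-! ### §3 The sharp descent step at `2` (non-eigen form, odd-`p` exponent) -/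

/-- **The descent step at `2` with the odd-`p` exponent, for an ARBITRARY class against an
anti-fixed tame value.** Data as above (`u`, `w`, `e`, `hω`); `y₀` with `ιy₀ = −y₀` and `2^a y₀ ≠ 0`;
`x` ARBITRARY with `e(x, y₀) = 0`. Then **`2^{M−a−1}·(x + ιx) = 0`**. (`r ∈ ℤy₀` is the element
of order `2` of the line `ℤw`, so `e(x, r) = 0`, `x = βu + δw` by §2, `x + ιx = 2βu`, and g2's
`pow_nsmul_eq_zero_of_pairing_eq_zero_two` for `βu` gives `2^{M−a}βu = 0`.)
[cite: McCallumLMS1991, §5 Lemma 5.3 (p odd analogue)] [cite: GrossLMS1991, Prop. 8.1 (p odd analogue)] -/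
theorem sharp_descent_step_two_of_generators [Finite T] (hM : 1 ≤ M) (hT : ∀ t : T, 2 ^ M • t = 0)
    (hcard : Nat.card T = 2 ^ (2 * M)) (ι : T →+ T) {u w : T} (hιu : ι u = u) (hιw : ι w = -w)
    (hQw : ∀ x, ι x = -x → x ∈ AddSubgroup.zmultiples w)
    (hou : addOrderOf u = 2 ^ M) (how : addOrderOf w = 2 ^ M)
    {A : Type*} [AddCommGroup A] (e : T →+ T →+ A) (halt : ∀ x, e x x = 0)
    (hnd : ∀ x, (∀ y, e x y = 0) → x = 0) (hω : addOrderOf (e u w) = 2 ^ (M - 1))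
    {x y₀ : T} (hy₀ : ι y₀ = -y₀) {a : ℕ} (ha : 2 ^ a • y₀ ≠ 0) (he : e x y₀ = 0) :
    2 ^ (M - a - 1) • (x + ι x) = 0 := by
  have hy₀w : y₀ ∈ AddSubgroup.zmultiples w := hQw y₀ hy₀
  -- the order of `y₀` is `2^j` with `1 ≤ j`, and `2^{j-1} y₀ = r`
  have hy₀0 : y₀ ≠ 0 := by rintro rfl; exact ha (smul_zero _)
  obtain ⟨j, hjM, hj⟩ : ∃ j ≤ M, addOrderOf y₀ = 2 ^ j :=
    (Nat.dvd_prime_pow Nat.prime_two).mp (addOrderOf_dvd_of_nsmul_eq_zero (hT y₀))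
  have hj1 : 1 ≤ j := by
    by_contra h0
    have : addOrderOf y₀ = 1 := by rw [hj]; simp [show j = 0 by omega]
    exact hy₀0 (AddMonoid.addOrderOf_eq_one_iff.mp this)
  set r' : T := 2 ^ (j - 1) • y₀ with hr'
  have hr'0 : r' ≠ 0 := by
    refine nsmul_ne_zero_of_lt_addOrderOf (pow_ne_zero _ two_ne_zero) ?_
    rw [hj]; exact Nat.pow_lt_pow_right (by norm_num) (by omega)
  have hr'2 : 2 • r' = 0 := by
    rw [hr', ← mul_nsmul', ← pow_succ', Nat.sub_add_cancel hj1, ← hj]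
    exact addOrderOf_nsmul_eq_zero y₀
  have hr'r : r' = 2 ^ (M - 1) • w :=
    (eq_zero_or_eq_of_mem_zmultiples_of_two_nsmul hM how (AddSubgroup.nsmul_mem _ hy₀w _) hr'2).resolve_left hr'0
  -- `e(x, r) = 0`, so `x = β u + δ w`
  have hxr : e x (2 ^ (M - 1) • w) = 0 := by rw [← hr'r, hr', map_nsmul, he, smul_zero]
  obtain ⟨β, δ, rfl⟩ := mem_sup_zmultiples_of_pairing_eq_zero hM hcard ι hιu hιw hou how e halt hnd hω hxr
  -- `x + ιx = 2 β u` and `e(βu, y₀) = 0`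
  have hsum : β • u + δ • w + ι (β • u + δ • w) = 2 • (β • u) := by
    rw [map_add, map_zsmul, map_zsmul, hιu, hιw, zsmul_neg, two_nsmul]; abel
  have hβ : e (β • u) y₀ = 0 := by
    obtain ⟨γ, rfl⟩ := AddSubgroup.mem_zmultiples_iff.mp hy₀w
    have h1 : e (β • u + δ • w) (γ • w) = e (β • u) (γ • w) + (δ * γ) • e w w := by
      rw [map_add, AddMonoidHom.add_apply, mul_comm, mul_zsmul, ← pairing_zsmul_left e δ,
        ← map_zsmul]
    rw [h1, halt, smul_zero, add_zero] at he
    exact he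
  have hstep := pow_nsmul_eq_zero_of_pairing_eq_zero_two hT e (AddSubgroup.zsmul_mem_zmultiples u β)
    hy₀w hω ha hβ
  -- `a < M` (as `2^M y₀ = 0`), so `2^{M-a-1} · 2 = 2^{M-a}`
  have haM : a < M := by
    by_contra h
    apply ha
    obtain ⟨k, hk⟩ : ∃ k, a = M + k := ⟨a - M, by omega⟩
    rw [hk, pow_add, mul_comm, mul_nsmul', hT, smul_zero]
  rw [hsum, ← mul_nsmul', ← pow_succ, show M - a - 1 + 1 = M - a by omega]
  exact hstep

/-- **The sharp descent step at `2`, packaged** (compare g2's `descent_step_two`): under the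
hypotheses of `exists_eigen_generators_two` (`T` killed by `2^M`, `#T = 4^M`, `#T[2] = 4`, `ι` an
involution moving some `2`-torsion vector) and for `e` alternating left-non-degenerate:
for EVERY `x` and every anti-fixed `y₀` with `2^a y₀ ≠ 0` and `e(x, y₀) = 0`, `2^{M−a−1}(x + ιx) = 0`;
and for every fixed `y₀` with `2^a y₀ ≠ 0` and `e(x, y₀) = 0`, `2^{M−a−1}(x − ιx) = 0` (apply the
first to the involution `−ι`). The exponent is McCallum's `p^{M−1−a}`.
[cite: McCallumLMS1991, §5 Lemma 5.3 (p odd analogue)] [cite: GrossLMS1991, Prop. 8.1 (p odd analogue)] -/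
theorem sharp_descent_step_two [Finite T] (hM : 1 ≤ M) (hT : ∀ t : T, 2 ^ M • t = 0)
    (hcard : Nat.card T = 2 ^ (2 * M)) (hcard2 : Nat.card {x : T // 2 • x = 0} = 2 ^ 2)
    (ι : T →+ T) (hι : ∀ x, ι (ι x) = x) {v₂ : T} (hv₂2 : 2 • v₂ = 0) (hv₂ : ι v₂ ≠ v₂)
    {A : Type*} [AddCommGroup A] (e : T →+ T →+ A) (halt : ∀ x, e x x = 0)
    (hnd : ∀ x, (∀ y, e x y = 0) → x = 0) :
    (∀ (x y₀ : T), ι y₀ = -y₀ → ∀ a : ℕ, 2 ^ a • y₀ ≠ 0 → e x y₀ = 0 →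
        2 ^ (M - a - 1) • (x + ι x) = 0) ∧
      (∀ (x y₀ : T), ι y₀ = y₀ → ∀ a : ℕ, 2 ^ a • y₀ ≠ 0 → e x y₀ = 0 →
        2 ^ (M - a - 1) • (x - ι x) = 0) := by
  constructor
  · intro x y₀ hy₀ a ha he
    obtain ⟨u, w, hιu, hιw, -, hQw, hou, how, -, h2, hmeet⟩ :=
      exists_eigen_generators_two hM hT hcard hcard2 ι hι hv₂2 hv₂
    have hmeet' : 2 ^ (M - 1) • u ∈ AddSubgroup.zmultiples w := by
      rw [hmeet, ← natCast_zsmul]; exact AddSubgroup.zsmul_mem_zmultiples w _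
    have hω := addOrderOf_pairing_eq_two hM hT e halt hnd hou h2 hmeet'
    exact sharp_descent_step_two_of_generators hM hT hcard ι hιu hιw hQw hou how e halt hnd hω hy₀ ha he
  · -- the involution `-ι` swaps the eigen-lines
    intro x y₀ hy₀ a ha he
    set ι' : T →+ T := -ι with hι'
    have hι'' : ∀ x, ι' (ι' x) = x := fun x ↦ by
      rw [hι', AddMonoidHom.neg_apply, AddMonoidHom.neg_apply, map_neg, neg_neg, hι]
    have hv₂' : ι' v₂ ≠ v₂ := by
      intro h
      apply hv₂
      rw [hι', AddMonoidHom.neg_apply] at h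
      -- `-ι v₂ = v₂` with `2 v₂ = 0` gives `ι v₂ = -v₂ = v₂`
      have hneg : -v₂ = v₂ := neg_eq_of_add_eq_zero_left (by rw [← two_nsmul]; exact hv₂2)
      exact (neg_eq_iff_eq_neg.mp h).trans hneg
    obtain ⟨u, w, hιu, hιw, -, hQw, hou, how, -, h2, hmeet⟩ :=
      exists_eigen_generators_two hM hT hcard hcard2 ι' hι'' hv₂2 hv₂'
    have hmeet' : 2 ^ (M - 1) • u ∈ AddSubgroup.zmultiples w := by
      rw [hmeet, ← natCast_zsmul]; exact AddSubgroup.zsmul_mem_zmultiples w _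
    have hω := addOrderOf_pairing_eq_two hM hT e halt hnd hou h2 hmeet'
    have hy₀' : ι' y₀ = -y₀ := by rw [hι', AddMonoidHom.neg_apply, hy₀]
    have h := sharp_descent_step_two_of_generators hM hT hcard ι' hιu hιw hQw hou how e halt hnd hω
      hy₀' ha he
    rw [hι', AddMonoidHom.neg_apply, ← sub_eq_add_neg] at h
    exact h

end Summit.BirchSwinnertonDyer.BirchSwinnertonDyer.Theorems.KolyvaginDescentTwo
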